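import Summits.ABC.IUTFork.ForkGenuineWindowSharpCond
import Summits.ABC.ABC.Theses.IUTThetaPilot
import HarnessLib

/-!
# Crux `ThetaPartII` (stmt-ABC-19678, route `IUTThetaPilot`), (U) line: the registered stub `stub_hullRegimeAbove` is
# FALSE as soon as ONE admissible point carries a deep lopsided split prime — a negative lemma MODULO an explicit
# arithmetic existence statement ([IUTchIV] Thm. 1.10 Step (v); Dupuy–Hilado §4.7, §4.12)

Record-only PROOF file (D-0012) of the abc-iut cell (campaign-S seat abc-iut-S4, gen 6); TAKES NO SIDE on [IUTchIII]
Cor. 3.12, on [IUTchIV] Thm. 1.10, or on the (U)/(P) readings of "`−|log(Θ)|`". The registered skeleton of the crux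
(abc-iut-c312-8, sha16 `0bf3ba3d3910cd8b`, RESHAPE-3) composes `ThetaPartII` on the UNION line from `stub_cor312` (the
disputed Corollary at the Θ-volume data) and `stub_hullRegimeAbove` — [IUTchIV] Thm. 1.10 Steps (iv)–(viii)'s hull-volume
estimate with print's constant `B(P,l)` at every genuine datum that is NOT slot-constant, for `2 ≤ d_mod` and `log(q^{∤{2,l}}(λ))`
above abc-iut-c312-d1's explicit threshold (VERDICT RISK ¶7). This seat's `ForkGenuineWindowSharpCond` (p444868/p445514, over
abc-iut-w6-d018's sharp window and abc-iut-S8's pair bound) shows what that estimate ASSERTS at a datum: at every support prime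
split into places `v, w` of `F_mod`,
`Pr(v)·Pr(w)·((ℓ⋇+1)(2ℓ⋇+1)/6)·(μ(v) − μ(w)) ≤ B(P,l) − ((ℓ⋇+3)/2 − d_mod)·(log-diff(λ) + (1 − 1/l)·log 𝔣^{F_tpd})`
(`μ(u) = P_q(u)·ln N(u)/n_u`). HENCE (`stub_hullRegimeAbove_false_of_deepLopsidedDatum`): IF there is an admissible `(P, l)` in
the stub's regime (`λ ∈ U_P` minimal, `l ≥ 5` prime, `AdmitsCore`, (P2), (P5), (P6), `2 ≤ d_mod`, above the threshold) with a
genuine Θ-volume datum `T` that is not slot-constant, has `[F_mod:ℚ] ≤ (ℓ⋇+3)/2`, and a support prime with two places VIOLATING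
that inequality, THEN the registered `stub_hullRegimeAbove` is FALSE. The antecedent is an explicit arithmetic EXISTENCE
statement (a hypothesis of an implication, not a fact of the tree): it asks for ONE point of the `λ`-line with a lopsided
split prime of normalised local height `≳ 12(4d_mod+2)/(l²·Pr·Pr)·(log-diff + log-cond) + 3(l+1)/(l²·Pr·Pr)·(2 log l + 52 +
(20/3)·l*_mod·log 𝔰^≤)` together with a CERTIFICATE of (P2)/(P6) there — no abc- or Szpiro-violating point. Whether such a
certificate can be produced for a point of the required height (≈ `10^9` digits at `l ≈ 10^3`) is a computational question
((P2) asks that no prime occur in `λ`, `1−λ` with multiplicity divisible by `l`), not settled here; nothing is asserted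
about it. This does NOT refute the crux `ThetaPartII`, the route, or [IUTchIV] Thm. 1.10: it concerns the (U)-line stub only
(the (P) line's volume stub is a theorem, abc-iut-c312-d1 p425589). [cite: Mochizuki2012, IUTchIV Thm. 1.10 Step (v) p. 27–29]
[cite: DupuyHilado2025, §4.7, §4.12] [claim: Mochizuki2012, status: disputed] for every IUT quotation. PROOF-ONLY file.
-/

noncomputable section

-- `Summit.<Summit>.<Problem>` is the mandated summit-side namespace (CONVENTIONS §2); for the
-- single-conjunct summit `ABC` the two coincide, so the duplicate `ABC.ABC` is deliberate.
set_option linter.dupNamespace false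

namespace Summit.ABC.ABC.Theorems.ThetaPartII.Negative

open Literature.NumberTheory.DiophantineGeometry.GenEll Literature.IUT.LogVolume Literature.IUT.HodgeTheaters
open Summit.ABC.IUTFork NumberField IsDedekindDomain

/-- **`stub_hullRegimeAbove` is false modulo ONE deep lopsided admissible datum.** If some admissible `(P, l)` in the
regime of the registered stub (`2 ≤ d_mod`, above abc-iut-c312-d1's explicit threshold) carries a genuine Θ-volume datum
`T` — not slot-constant, with `[F_mod:ℚ] ≤ (ℓ⋇+3)/2` — and a support prime `p` with places `v, w` of `F_mod` such that
`Pr(v)·Pr(w)·((ℓ⋇+1)(2ℓ⋇+1)/6)·(μ(v) − μ(w)) > B(P,l) − ((ℓ⋇+3)/2 − [F_mod:ℚ])·(log-diff(λ) + (1 − 1/l)·log 𝔣^{F_tpd})`, then the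
statement registered as `stub_hullRegimeAbove` (the `habove` binder of `ABC_of_cor312_of_hullRegimeAbove`) fails: it would give
`T.HullEstimateOf (B P l)`, whence the reverse inequality by this seat's `ForkGenuineWindowSharpCond` chain
(`GenuineContent.slotResidue_add_mul_ndeg_le_of_hullEstimateOf`, `Cor22.ThetaVolumeDatumAt.ndeg_differentDivisor_ge`) and
abc-iut-S8's `PilotData.slotResidue_ge_pair_closed`. An implication; its antecedent is NOT asserted. No side taken.
[cite: Mochizuki2012, IUTchIV Thm. 1.10 Step (v) p. 27–29] [claim: Mochizuki2012, status: disputed] -/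
theorem stub_hullRegimeAbove_false_of_deepLopsidedDatum
    (H : ∃ (P : NFPoint) (_ : P ∈ UP) (l : ℕ) (_ : l.Prime) (_ : 5 ≤ l) (_ : Cor22.AdmitsCore P)
        (_ : Cor22.CondP2 P l) (_ : Cor22.CondP5 P l) (_ : Cor22.CondP6 P l) (_ : 2 ≤ Cor22.dmod P)
        (_ : 40 * Real.log (((2 ^ 12 * 3 ^ 3 * 5 * Cor22.dmod P : ℕ) : ℝ) * l)
          * ((Nat.primeCounting (2 ^ 12 * 3 ^ 3 * 5 * Cor22.dmod P * l) : ℝ)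
            - (2 * (Cor22.dmod P : ℝ) * (P.logDiff + Cor22.logCondAvoid P {2, l}) + Real.log (2 * 3 * 5 * (l : ℝ)))
              / Real.log 2) < Cor22.logQAvoid P {2, l})
        (T : Cor22.ThetaVolumeDatumAt P l),
        (letI := T.instFieldF; letI := T.instNumberFieldF; letI := T.instAlgebraF; letI := T.instFieldK
         letI := T.instNumberFieldK; letI := T.instAlgebraK; letI := T.instFieldFbar; letI := T.instAlgebraFbar
         letI := T.instAlgebraKFbar; letI := T.instIsElliptic
         ¬ (∀ p ∈ T.I.supportPrimes, ∀ v w : placesOver (fieldOfModuli T.E) p,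
            (DHData.ofInput T.I).logQloc p v = (DHData.ofInput T.I).logQloc p w) ∧
         (Module.finrank ℚ (fieldOfModuli T.E) : ℝ) ≤ ((T.I.X.lstar : ℝ) + 3) / 2 ∧
         ∃ (p : ℕ) (hp : p.Prime) (_ : p ∈ T.I.supportPrimes),
           haveI : Fact p.Prime := ⟨hp⟩
           ∃ v w : placesOver (fieldOfModuli T.E) p,
             ((l : ℝ) + 1) / 4 *
                 ((1 + 12 * (Cor22.dmod P : ℝ) / l) * (P.logDiff + Cor22.logCondAvoid P {2, l})
                   + 2 * Real.log l + 52
                   + 20 / 3 * Real.log (((2 ^ 12 * 3 ^ 3 * 5 * Cor22.dmod P : ℕ) : ℝ) * (l : ℝ))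
                     * (Nat.primeCounting (2 ^ 12 * 3 ^ 3 * 5 * Cor22.dmod P * l) : ℝ))
               - (((T.I.X.lstar : ℝ) + 3) / 2 - Module.finrank ℚ (fieldOfModuli T.E)) *
                   (P.logDiff + (1 - 1 / (l : ℝ)) * Cor22.logCondAvoid P {2, l}) <
             weight (fieldOfModuli T.E) v.1 * weight (fieldOfModuli T.E) w.1 *
                 ((((T.I.X.lstar : ℝ) + 1) * (2 * T.I.X.lstar + 1)) / 6) *
               (T.I.X.qPilot v.1 * logNorm (fieldOfModuli T.E) v.1 / (localDegree (fieldOfModuli T.E) v.1 : ℝ)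
                 - T.I.X.qPilot w.1 * logNorm (fieldOfModuli T.E) w.1 /
                   (localDegree (fieldOfModuli T.E) w.1 : ℝ)))) :
    ¬ (∀ P : NFPoint, P ∈ UP → ∀ l : ℕ, l.Prime → 5 ≤ l →
        Cor22.AdmitsCore P → Cor22.CondP2 P l → Cor22.CondP5 P l → Cor22.CondP6 P l →
        2 ≤ Cor22.dmod P →
        40 * Real.log (((2 ^ 12 * 3 ^ 3 * 5 * Cor22.dmod P : ℕ) : ℝ) * l)
          * ((Nat.primeCounting (2 ^ 12 * 3 ^ 3 * 5 * Cor22.dmod P * l) : ℝ)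
            - (2 * (Cor22.dmod P : ℝ) * (P.logDiff + Cor22.logCondAvoid P {2, l}) + Real.log (2 * 3 * 5 * (l : ℝ)))
              / Real.log 2) < Cor22.logQAvoid P {2, l} →
        ∀ T : Cor22.ThetaVolumeDatumAt P l,
          (letI := T.instFieldF; letI := T.instNumberFieldF; letI := T.instAlgebraF; letI := T.instFieldK
           letI := T.instNumberFieldK; letI := T.instAlgebraK; letI := T.instFieldFbar; letI := T.instAlgebraFbar
           letI := T.instAlgebraKFbar; letI := T.instIsElliptic
           ¬ (∀ p ∈ T.I.supportPrimes, ∀ v w : placesOver (fieldOfModuli T.E) p,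
              (DHData.ofInput T.I).logQloc p v = (DHData.ofInput T.I).logQloc p w)) →
          T.HullEstimateOf
            (((l : ℝ) + 1) / 4 *
              ((1 + 12 * (Cor22.dmod P : ℝ) / l) * (P.logDiff + Cor22.logCondAvoid P {2, l})
                + 2 * Real.log l + 52
                + 20 / 3 * Real.log (((2 ^ 12 * 3 ^ 3 * 5 * Cor22.dmod P : ℕ) : ℝ) * (l : ℝ))
                  * (Nat.primeCounting (2 ^ 12 * 3 ^ 3 * 5 * Cor22.dmod P * l) : ℝ)))) := by
  intro habove
  obtain ⟨P, hP, l, hl, h5, hcore, h2, h5', h6, hd2, hthr, T, hrest⟩ := H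
  letI := T.instFieldF; letI := T.instNumberFieldF; letI := T.instAlgebraF; letI := T.instFieldK
  letI := T.instNumberFieldK; letI := T.instAlgebraK; letI := T.instFieldFbar; letI := T.instAlgebraFbar
  letI := T.instAlgebraKFbar; letI := T.instIsElliptic
  obtain ⟨hnsc, hd, p, hp, hpT, v, w, hlt⟩ := hrest
  haveI : Fact p.Prime := ⟨hp⟩
  -- the stub gives the hull estimate with `B(P,l)` at `T`
  have hEst := habove P hP l hl h5 hcore h2 h5' h6 hd2 hthr T hnsc
  -- the sharp lower window in `log(𝔡^K)`-currency, the Step (ii) lower bound, and the pair bound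
  haveI := T.isGalois_fieldOfModuli_K
  have h1 := GenuineContent.slotResidue_add_mul_ndeg_le_of_hullEstimateOf T.I hEst
  have h2' := T.ndeg_differentDivisor_ge hl.pos
  have hc : 0 ≤ ((T.I.X.lstar : ℝ) + 3) / 2 - Module.finrank ℚ (fieldOfModuli T.E) := by linarith
  have h3 := mul_le_mul_of_nonneg_left h2' hc
  have h4 := T.I.X.slotResidue_ge_pair_closed T.I.supportPrimes hpT v w
  change T.I.X.slotResidue T.I.supportPrimes +
      (((T.I.X.lstar : ℝ) + 3) / 2 - Module.finrank ℚ (fieldOfModuli T.E)) * ndeg T.K (differentDivisor T.K) ≤ _ at h1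
  change P.logDiff + (1 - 1 / (l : ℝ)) * Cor22.logCondAvoid P {2, l} ≤ ndeg T.K (differentDivisor T.K) at h2'
  linarith

end Summit.ABC.ABC.Theorems.ThetaPartII.Negative

end
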